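import Mathlib
import Literature.Combinatorics.Hinz2018.FourInARowTower
import HarnessLib

/-!
# Berend–Sapir–Solomon's bound `Path(4,n) < 1.6·√n·3^{√(2n)}` for the Four-in-a-row Tower of Hanoi — PROVED

Discharge of the named fact `Literature.Combinatorics.Hinz2018.MoveGraph.BerendSapirSolomonBound` of
`Literature/Combinatorics/Hinz2018/FourInARowTower.lean` (Hinz–Klavžar–Petr 2018, Ch. 8 §8.3.5, pp. 349–350,
quoting [50] = D. Berend, A. Sapir, S. Solomon, *The Tower of Hanoi problem on Pathₕ graphs*, Discrete Appl.
Math. 160 (2012) 1465–1483, Theorem 3.2 (b): «Path($4,n$) $< 1.6 \sqrt{n} 3^{\sqrt{2n}}$» for `n ≥ 1`), as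
`BerendSapirSolomonBound_holds`, by the PRINTED PROOF of [50, §4.2] (held preprint `paper:arxiv-1102.4885`,
pp. 6–7), on the tree's labels (`path4 = 0 – 1 – 2 – 3`, states `Fin n → Fin 4`, index `0` = smallest disc):

* **The algorithm `FourMove` as a distance recurrence** (`bss_fourMove_recurrence`): for all `k, l`,
  `d(0^{k+l+1}, 3^{k+l+1}) ≤ 3·d(0^k, 3^k) + 3·(3^l − 1) + (3^l − 1)/2 + 3` — [50, §4.2, eq. for `T(n)`]:
  «`T(n) = 3·T(n−m) + (7/2)·(3^{m−1} − 1) + 3`» with `m = l + 1`, `n − m = k`. The block `B` of `n = k+l+1`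
  discs is split into the `k` smallest discs `B_s`, the `l = m − 1` next discs `B_l` and the largest disc;
  the eleven junction states of Spread ∕ Circular shift ∕ Accumulate are the states `bst k l a b c` (`B_s` on
  `a`, `B_l` on `b`, the largest disc on `c`), and each leg is bounded by a graph homomorphism into
  `H^{k+l+1}_{P_{1+3}}`: the three transfers of `B_s` (an optimal walk of `H^k_{P_{1+3}}` with the larger discs
  idle, in arbitrary fixed positions — «larger discs never block smaller ones»), the four transfers of `B_l`
  (the Linear TH of Chapter 2 on three consecutive pegs, `3^l − 1` moves end-to-end and `(3^l − 1)/2` moves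
  middle-to-end = the Lu weight of `0^l`, with `B_s` parked on the remaining end peg), and the three single
  moves of the largest disc.
* **The analysis** (`BerendSapirSolomonBound_holds`): the printed induction — base `n ≤ 8` («the inequality
  has been verified manually for all values of n ≤ 8»: here from the recurrence values
  `3, 10, 19, 40, 61, 88, 151, 214` against explicit lower bounds of `1.6√n·3^{√(2n)}`), step `n ≥ 9` with
  `m = round(√(2n))`, `s = √(2n)`, `γ = m − s + ½ ∈ (0, 1]`: «`√(1 − m/n) < 1 − 1/√(2n) − (2β+1)/(4n)`»
  (here: `√(s² − 2m) ≤ s − 1 − γ/s`, by squaring), «`e^x ≤ 1 + x + ½x²` for `x < 0`» (here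
  `e^{−y} ≤ 1 − y + y²/2`, `y ≥ 0`), `e^{−y} ≥ 1 − y`, `3^γ ≤ 1 + 2γ` (weighted AM–GM) and the decimal
  bounds on `log 3` of Mathlib; the printed two-page chain of estimates is compressed into one explicit
  polynomial inequality (`bss_key`) with the same worst case `β = ½`, `n = 9` and a margin `> 0.08`.

Everything here is a `theorem` (no new definition of record and no new named fact); helpers are
`private`. The named fact itself stays untouched in its file; its users feed `(h : BerendSapirSolomonBound)`
with `BerendSapirSolomonBound_holds`.

## References

* [HinzKlavzarPetr2018] A. M. Hinz, S. Klavžar, C. Petr, *The Tower of Hanoi – Myths and Maths*, 2nd ed.,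
  Birkhäuser 2018, Ch. 8 §8.3.5, pp. 349–350.
* [BerendSapirSolomon2012] D. Berend, A. Sapir, S. Solomon, *The Tower of Hanoi problem on Pathₕ graphs*,
  Discrete Appl. Math. 160 (2012) 1465–1483 (= arXiv:1102.4885), Theorem 3.2 (b), §4.2 Algorithm `FourMove`
  and the proof following it.
-/

namespace Literature.Combinatorics.Hinz2018.MoveGraph

open SimpleGraph

/-! ## Tools: idle larger discs in arbitrary positions; a move of the largest disc -/

section Tools

variable {V : Type*}

/-- `s ↦ s t`: a state of the `m` smallest discs with `ℓ` idle larger discs appended in FIXED positions `t` is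
a graph homomorphism `H_G^m → H_G^{m+ℓ}` for any move graph (larger discs never block smaller ones); the
tree's `idleHom` is the case of a constant `t` (tool, existence form). [folklore] -/
private theorem bss_exists_idleHom (M : SimpleGraph V) (m ℓ : ℕ) (t : Fin ℓ → V) :
    ∃ φ : stateGraph M m →g stateGraph M (m + ℓ), ∀ s, φ s = Fin.append s t := by
  refine ⟨⟨fun s => Fin.append s t, ?_⟩, fun s => rfl⟩
  intro s s' h
  obtain ⟨d, had, hoff, hsm⟩ := h
  refine ⟨Fin.castAdd ℓ d, by simpa only [Fin.append_left] using had, fun e he => ?_,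
    fun e he => ?_⟩
  · induction e using Fin.addCases with
    | left a =>
      simp only [Fin.append_left]
      exact hoff a fun h => he (by rw [h])
    | right b => simp only [Fin.append_right]
  · induction e using Fin.addCases with
    | left a =>
      simp only [Fin.append_left]
      exact hsm a (by rw [Fin.lt_def] at he ⊢; simpa using he)
    | right b =>
      exfalso
      rw [Fin.lt_def] at he
      simp only [Fin.val_natAdd, Fin.val_castAdd] at he
      omega

/-- One move of the largest disc along an edge `i j` of the move graph while every smaller disc avoids
both `i` and `j` (tool). [folklore] -/
private theorem bss_largest_move_adj (M : SimpleGraph V) (m : ℕ) {i j : V} (s : Fin m → V)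
    (h : M.Adj i j) (hs : ∀ e, s e ≠ i ∧ s e ≠ j) :
    (stateGraph M (m + 1)).Adj (Fin.append s (fun _ : Fin 1 => i))
      (Fin.append s (fun _ : Fin 1 => j)) := by
  refine ⟨Fin.natAdd m 0, by simpa only [Fin.append_right] using h, fun e he => ?_, fun e he => ?_⟩
  · induction e using Fin.addCases with
    | left a => simp only [Fin.append_left]
    | right b => exact absurd (by rw [Subsingleton.elim b 0]) he
  · induction e using Fin.addCases with
    | left a => simp only [Fin.append_left, Fin.append_right]; exact hs a
    | right b =>
      exfalso
      rw [Fin.lt_def] at he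
      simp only [Fin.val_natAdd] at he
      omega

/-- Distances do not increase under a graph homomorphism from a connected graph (tool). [folklore] -/
private theorem bss_dist_map_le {W : Type*} {G : SimpleGraph V} {G' : SimpleGraph W}
    (hG : G.Connected) (φ : G →g G') (u v : V) : G'.dist (φ u) (φ v) ≤ G.dist u v := by
  obtain ⟨p, hp⟩ := hG.exists_walk_length_eq_dist u v
  have h := SimpleGraph.dist_le (p.map φ)
  rwa [SimpleGraph.Walk.length_map, hp] at h

end Tools

/-! ## The legs of `FourMove` in `H^{k+l+1}_{P_{1+3}}` -/

/-- `P_{1+3}` is connected. [folklore] -/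
private theorem bss_path4_connected : path4.Connected := by
  rw [path4_eq_pathGraph]; exact SimpleGraph.pathGraph_connected 3

/-- `H^n_{P_{1+3}}` is connected (Theorem 8.7 of the book, by name). [folklore] -/
private theorem bss_state_connected (n : ℕ) : (stateGraph path4 n).Connected :=
  stateGraph_connected bss_path4_connected (by rw [Fintype.card_fin]; norm_num) n

/-- `H^l_{3,lin}` is connected (Chapter 2, by name). [folklore] -/
private theorem bss_lin_connected (l : ℕ) : (stateGraph linearGraph l).Connected := by
  rw [stateGraph_linearGraph]; exact linHanoiGraph_connected l

/-- A transfer of the `k` smallest discs `B_s` from `a` to `a'` under the idle blocks `B_l` (`l` discs on `b`)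
and the largest disc (on `c`) costs at most `d_{H^k}(a^k, a'^k)` moves (the sub-walks `M_s`, `M_s⁻¹` of
`FourMove`). [folklore] -/
private theorem bss_dist_small (k l : ℕ) (a a' b c : Fin 4) :
    (stateGraph path4 (k + l + 1)).dist
        (Fin.append (Fin.append (fun _ : Fin k => a) (fun _ : Fin l => b)) (fun _ : Fin 1 => c))
        (Fin.append (Fin.append (fun _ : Fin k => a') (fun _ : Fin l => b)) (fun _ : Fin 1 => c)) ≤
      (stateGraph path4 k).dist (fun _ => a) (fun _ => a') := by
  obtain ⟨φ, hφ⟩ := bss_exists_idleHom path4 k l (fun _ => b)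
  have h1 := bss_dist_map_le (bss_state_connected k) φ (fun _ => a) (fun _ => a')
  rw [hφ, hφ] at h1
  exact (bss_dist_map_le (bss_state_connected (k + l)) (idleHom path4 (k + l) 1 c) _ _).trans h1

/-- A transfer of `B_l` on three consecutive pegs (read through an injective edge-preserving `ρ` from the
Linear TH's pegs `1 – 0 – 2`), with `B_s` parked on the fourth peg `a` and the largest disc idle on `c`, costs
at most the corresponding distance of the Linear TH (the sub-walks `(B_l, s, d, a)` of `FourMove`). [folklore] -/
private theorem bss_dist_large (k l : ℕ) (ρ : ZMod 3 → Fin 4) (hρ : Function.Injective ρ)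
    (hadj : ∀ a b, linearGraph.Adj a b → path4.Adj (ρ a) (ρ b)) (a c : Fin 4) (ha : ∀ x, a ≠ ρ x)
    (x y : ZMod 3) :
    (stateGraph path4 (k + l + 1)).dist
        (Fin.append (Fin.append (fun _ : Fin k => a) (fun _ : Fin l => ρ x)) (fun _ : Fin 1 => c))
        (Fin.append (Fin.append (fun _ : Fin k => a) (fun _ : Fin l => ρ y)) (fun _ : Fin 1 => c)) ≤
      (stateGraph linearGraph l).dist (perfectWord l x) (perfectWord l y) :=
  (bss_dist_map_le (bss_state_connected (k + l)) (idleHom path4 (k + l) 1 c) _ _).trans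
    (bss_dist_map_le (bss_lin_connected l) (parkEmbHom linearGraph path4 k l ρ hρ hadj a ha)
      (perfectWord l x) (perfectWord l y))

/-- A move of the largest disc `i → j` while `B_s` (on `a`) and `B_l` (on `b`) avoid `i` and `j` (the moves
`t_{i,j,n}` of `FourMove`). [folklore] -/
private theorem bss_dist_max (k l : ℕ) (a b : Fin 4) {i j : Fin 4} (h : path4.Adj i j) (hai : a ≠ i)
    (haj : a ≠ j) (hbi : b ≠ i) (hbj : b ≠ j) :
    (stateGraph path4 (k + l + 1)).dist
        (Fin.append (Fin.append (fun _ : Fin k => a) (fun _ : Fin l => b)) (fun _ : Fin 1 => i))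
        (Fin.append (Fin.append (fun _ : Fin k => a) (fun _ : Fin l => b)) (fun _ : Fin 1 => j)) ≤ 1 := by
  refine le_of_eq (SimpleGraph.dist_eq_one_iff_adj.mpr ?_)
  refine bss_largest_move_adj path4 (k + l) _ h fun e => ?_
  induction e using Fin.addCases with
  | left y => simp only [Fin.append_left]; exact ⟨hai, haj⟩
  | right y => simp only [Fin.append_right]; exact ⟨hbi, hbj⟩

/-- The Lu weight of the middle perfect state: `d(0^l, 1^l) = (3^l − 1)/2` in `H^l_{3,lin}` («half that number
of moves between neighboring pegs», [50, §4.2]). [folklore] -/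
private theorem bss_luWeight_perfectWord_zero (l : ℕ) :
    luWeight l (perfectWord l 0) = (3 ^ l - 1) / 2 := by
  induction l with
  | zero => rfl
  | succ n ih =>
    have hs : perfectWord (n + 1) 0 = Fin.snoc (perfectWord n 0) 0 := by
      funext i
      refine Fin.lastCases ?_ (fun j => ?_) i <;> simp [perfectWord]
    rw [hs, luWeight_snoc_zero, ih]
    obtain ⟨t, ht⟩ : Odd (3 ^ n) := Odd.pow (by decide)
    rw [pow_succ, ht]
    omega

/-- Middle-to-end transfer of the Linear TH: `(3^l − 1)/2` moves. [folklore] -/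
private theorem bss_lin_dist_zero_one (l : ℕ) :
    (stateGraph linearGraph l).dist (perfectWord l 0) (perfectWord l 1) = (3 ^ l - 1) / 2 := by
  rw [stateGraph_linearGraph, lin_dist_perfectWord_one, bss_luWeight_perfectWord_zero]

/-- **The algorithm `FourMove` of [50, §4.2] as a distance recurrence in `H^n_{P_{1+3}}`** (tree's labels, end
pegs `0` and `3`): for every splitting `n = k + l + 1` of the block into its `k` smallest discs `B_s`, the next
`l = m − 1` discs `B_l` and the largest disc, `d(0^n, 3^n) ≤ 3·d(0^k, 3^k) + 3(3^l − 1) + (3^l − 1)/2 + 3` —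
the printed «`T(n) = 3·T(n−m) + (7/2)·(3^{m−1} − 1) + 3`» for the optimal values. Junction states (written
`(B_s, B_l, largest)`): Spread `(0,0,0) → (3,0,0) → (3,2,0) → (3,2,1)`; Circular shift `→ (0,2,1) → (0,3,1) →
(0,3,2) → (0,1,2)`; Accumulate `→ (0,1,3) → (0,3,3) → (3,3,3)`; the `B_l` legs cost `3^l − 1`, `(3^l − 1)/2`,
`3^l − 1`, `3^l − 1` (three-in-a-row transfers between the far pegs, resp. from the middle peg to an end peg:
«requiring `3ⁿ − 1` moves to transfer n disks between the two farthest pegs, and half that number of moves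
between neighboring pegs»).
[cite: HinzKlavzarPetr2018, Ch. 8 §8.3.5, pp. 349–350 (ref. 50 = Berend–Sapir–Solomon, Discrete Appl. Math. 160 (2012), §4.2, Algorithm FourMove and the recurrence for T(n))]
[cite: BerendSapirSolomon2012, §4.2, Algorithm FourMove and the recurrence T(n) = 3T(n−m) + (7/2)(3^{m−1} − 1) + 3] -/
theorem bss_fourMove_recurrence (k l : ℕ) :
    (stateGraph path4 (k + l + 1)).dist (fun _ => 0) (fun _ => 3) ≤
      3 * (stateGraph path4 k).dist (fun _ => 0) (fun _ => 3) +
        (3 * (3 ^ l - 1) + (3 ^ l - 1) / 2 + 3) := by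
  have hc : (stateGraph path4 (k + l + 1)).Connected := bss_state_connected _
  have hsym : (stateGraph path4 k).dist (fun _ => (3 : Fin 4)) (fun _ => 0) =
      (stateGraph path4 k).dist (fun _ => 0) (fun _ => 3) := SimpleGraph.dist_comm
  -- the junction states: `B_s` on `a`, `B_l` on `b`, the largest disc on `c`
  set S : Fin 4 → Fin 4 → Fin 4 → (Fin (k + l + 1) → Fin 4) := fun a b c =>
    Fin.append (Fin.append (fun _ : Fin k => a) (fun _ : Fin l => b)) (fun _ : Fin 1 => c) with hS
  have hconst : ∀ a, S a a a = fun _ => a := by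
    intro a
    funext x
    simp only [hS]
    induction x using Fin.addCases with
    | left y =>
      rw [Fin.append_left]
      induction y using Fin.addCases with
      | left z => rw [Fin.append_left]
      | right z => rw [Fin.append_right]
    | right y => rw [Fin.append_right]
  have hρi : Function.Injective (![1, 0, 2] : ZMod 3 → Fin 4) := by decide
  have hρa : ∀ a b, linearGraph.Adj a b → path4.Adj ((![1, 0, 2] : ZMod 3 → Fin 4) a)
      ((![1, 0, 2] : ZMod 3 → Fin 4) b) := by decide
  -- Spread
  have h01 : (stateGraph path4 (k + l + 1)).dist (S 0 0 0) (S 3 0 0) ≤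
      (stateGraph path4 k).dist (fun _ => 0) (fun _ => 3) := bss_dist_small k l 0 3 0 0
  have h12 : (stateGraph path4 (k + l + 1)).dist (S 3 0 0) (S 3 2 0) ≤ 3 ^ l - 1 :=
    (bss_dist_large k l ![1, 0, 2] hρi hρa 3 0 (by decide) 1 2).trans_eq (linear_three_pegs_easy l)
  have h23 : (stateGraph path4 (k + l + 1)).dist (S 3 2 0) (S 3 2 1) ≤ 1 :=
    bss_dist_max k l 3 2 (by decide) (by decide) (by decide) (by decide) (by decide)
  -- Circular shift
  have h34 : (stateGraph path4 (k + l + 1)).dist (S 3 2 1) (S 0 2 1) ≤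
      (stateGraph path4 k).dist (fun _ => 0) (fun _ => 3) :=
    (bss_dist_small k l 3 0 2 1).trans_eq hsym
  have h45 : (stateGraph path4 (k + l + 1)).dist (S 0 2 1) (S 0 3 1) ≤ (3 ^ l - 1) / 2 :=
    (bss_dist_large k l linPegs linPegs_injective linPegs_adj 0 1 (by decide) 0 1).trans_eq
      (bss_lin_dist_zero_one l)
  have h56 : (stateGraph path4 (k + l + 1)).dist (S 0 3 1) (S 0 3 2) ≤ 1 :=
    bss_dist_max k l 0 3 (by decide) (by decide) (by decide) (by decide) (by decide)
  have h67 : (stateGraph path4 (k + l + 1)).dist (S 0 3 2) (S 0 1 2) ≤ 3 ^ l - 1 :=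
    (bss_dist_large k l linPegs linPegs_injective linPegs_adj 0 2 (by decide) 1 2).trans_eq
      (linear_three_pegs_easy l)
  -- Accumulate
  have h78 : (stateGraph path4 (k + l + 1)).dist (S 0 1 2) (S 0 1 3) ≤ 1 :=
    bss_dist_max k l 0 1 (by decide) (by decide) (by decide) (by decide) (by decide)
  have h89 : (stateGraph path4 (k + l + 1)).dist (S 0 1 3) (S 0 3 3) ≤ 3 ^ l - 1 :=
    (bss_dist_large k l linPegs linPegs_injective linPegs_adj 0 3 (by decide) 2 1).trans_eq
      (SimpleGraph.dist_comm.trans (linear_three_pegs_easy l))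
  have h910 : (stateGraph path4 (k + l + 1)).dist (S 0 3 3) (S 3 3 3) ≤
      (stateGraph path4 k).dist (fun _ => 0) (fun _ => 3) := bss_dist_small k l 0 3 3 3
  -- triangle inequalities along the eleven junction states
  have t1 := hc.dist_triangle (u := S 0 0 0) (v := S 3 0 0) (w := S 3 3 3)
  have t2 := hc.dist_triangle (u := S 3 0 0) (v := S 3 2 0) (w := S 3 3 3)
  have t3 := hc.dist_triangle (u := S 3 2 0) (v := S 3 2 1) (w := S 3 3 3)
  have t4 := hc.dist_triangle (u := S 3 2 1) (v := S 0 2 1) (w := S 3 3 3)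
  have t5 := hc.dist_triangle (u := S 0 2 1) (v := S 0 3 1) (w := S 3 3 3)
  have t6 := hc.dist_triangle (u := S 0 3 1) (v := S 0 3 2) (w := S 3 3 3)
  have t7 := hc.dist_triangle (u := S 0 3 2) (v := S 0 1 2) (w := S 3 3 3)
  have t8 := hc.dist_triangle (u := S 0 1 2) (v := S 0 1 3) (w := S 3 3 3)
  have t9 := hc.dist_triangle (u := S 0 1 3) (v := S 0 3 3) (w := S 3 3 3)
  have key : (stateGraph path4 (k + l + 1)).dist (S 0 0 0) (S 3 3 3) ≤
      3 * (stateGraph path4 k).dist (fun _ => 0) (fun _ => 3) +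
        (3 * (3 ^ l - 1) + (3 ^ l - 1) / 2 + 3) := by
    omega
  rwa [hconst, hconst] at key

/-- `d(0^0, 3^0) = 0`: with no disc there is one state. [folklore] -/
private theorem bss_dist_zero :
    (stateGraph path4 0).dist (fun _ => (0 : Fin 4)) (fun _ => 3) = 0 := by
  have h : (fun _ : Fin 0 => (0 : Fin 4)) = fun _ => 3 := funext fun x => x.elim0
  rw [h, SimpleGraph.dist_self]

/-! ## The analysis of [50, §4.2]: real-number estimates -/

section Analysis

/-- `3^γ ≤ 1 + 2γ` on `[0,1]` (weighted AM–GM, i.e. convexity of `3^γ`). [folklore] -/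
private theorem bss_three_rpow_le {γ : ℝ} (h0 : 0 ≤ γ) (h1 : γ ≤ 1) : (3 : ℝ) ^ γ ≤ 1 + 2 * γ := by
  have h := Real.geom_mean_le_arith_mean2_weighted (w₁ := γ) (w₂ := 1 - γ) (p₁ := 3) (p₂ := 1) h0
    (by linarith) (by norm_num) (by norm_num) (by ring)
  rw [Real.one_rpow, mul_one] at h
  linarith

/-- `e^{-y} ≤ 1 − y + y²/2` for `y ≥ 0` (the printed «`e^x ≤ 1 + x + ½x²` for `x < 0`»). [folklore] -/
private theorem bss_exp_neg_le {y : ℝ} (hy : 0 ≤ y) : Real.exp (-y) ≤ 1 - y + y ^ 2 / 2 := by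
  have hP := Real.quadratic_le_exp_of_nonneg hy
  have hE : Real.exp (-y) * Real.exp y = 1 := by rw [← Real.exp_add]; simp
  have hEpos := Real.exp_pos (-y)
  have h1 : Real.exp (-y) * (1 + y + y ^ 2 / 2) ≤ 1 := by
    calc Real.exp (-y) * (1 + y + y ^ 2 / 2) ≤ Real.exp (-y) * Real.exp y :=
          mul_le_mul_of_nonneg_left hP hEpos.le
      _ = 1 := hE
  have hPpos : 0 < 1 + y + y ^ 2 / 2 := by positivity
  have hPQ : (1 + y + y ^ 2 / 2) * (1 - y + y ^ 2 / 2) = 1 + y ^ 4 / 4 := by ring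
  by_contra hlt
  push Not at hlt
  have : 1 + y ^ 4 / 4 < 1 := by
    calc 1 + y ^ 4 / 4 = (1 + y + y ^ 2 / 2) * (1 - y + y ^ 2 / 2) := hPQ.symm
      _ < (1 + y + y ^ 2 / 2) * Real.exp (-y) := mul_lt_mul_of_pos_left hlt hPpos
      _ = Real.exp (-y) * (1 + y + y ^ 2 / 2) := mul_comm _ _
      _ ≤ 1 := h1
  nlinarith [sq_nonneg (y ^ 2)]

/-- The polynomial heart of the printed estimate (worst case `β = ½`, `n = 9`): for `s ≥ 4.2` and
`γ ∈ (0, 1]`, `(s − 1 − γ/s)·3^{−γ/s} + 0.596·3^γ ≤ s`. [folklore] -/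
private theorem bss_key {s γ : ℝ} (hs : 4.2 ≤ s) (hγ0 : 0 < γ) (hγ1 : γ ≤ 1) :
    (s - 1 - γ / s) * (3 : ℝ) ^ (-(γ / s)) + 0.596 * (3 : ℝ) ^ γ ≤ s := by
  set L := Real.log 3 with hL
  have hL1 : 1.0986 < L := by have := Real.log_three_gt_d9; rw [hL]; linarith
  have hL2 : L < 1.0987 := by have := Real.log_three_lt_d9; rw [hL]; linarith
  have hs0 : 0 < s := by linarith
  set x := γ / s with hx
  have hx0 : 0 < x := div_pos hγ0 hs0
  have hxs : x * s = γ := by rw [hx]; field_simp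
  have hx1 : x ≤ 0.2381 := by
    rw [hx, div_le_iff₀ hs0]; nlinarith
  -- `3^{-x} = e^{-y}`, `y = xL`
  set y := x * L with hy
  have hy0 : 0 ≤ y := by positivity
  have hE : (3 : ℝ) ^ (-(γ / s)) = Real.exp (-y) := by
    rw [Real.rpow_def_of_pos (by norm_num : (0 : ℝ) < 3), ← hL, ← hx, hy]; ring_nf
  have hEup : Real.exp (-y) ≤ 1 - y + y ^ 2 / 2 := bss_exp_neg_le hy0
  have hElo : 1 - y ≤ Real.exp (-y) := Real.one_sub_le_exp_neg y
  have h3γ : (3 : ℝ) ^ γ ≤ 1 + 2 * γ := bss_three_rpow_le hγ0.le hγ1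
  have hσ : 0 ≤ s - 1 - γ / s := by
    rw [← hx]; linarith
  rw [hE]
  -- split `(s - 1 - x)·E = s·E − (1 + x)·E`
  have hsE : s * Real.exp (-y) ≤ s * (1 - y + y ^ 2 / 2) := mul_le_mul_of_nonneg_left hEup hs0.le
  have h1E : (1 + x) * (1 - y) ≤ (1 + x) * Real.exp (-y) :=
    mul_le_mul_of_nonneg_left hElo (by linarith)
  have hc : 0.596 * (3 : ℝ) ^ γ ≤ 0.596 * (1 + 2 * γ) := by nlinarith
  -- the polynomial inequality
  have hsy : s * y = γ * L := by rw [hy, ← hxs]; ring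
  have hsy2 : s * y ^ 2 = γ * x * L ^ 2 := by rw [hy, ← hxs]; ring
  have hL2sq : L ^ 2 ≤ 1.2072 := by nlinarith
  have hγx : γ * x ≤ x := by nlinarith
  have hpoly : s * (1 - y + y ^ 2 / 2) - (1 + x) * (1 - y) + 0.596 * (1 + 2 * γ) ≤ s := by
    have e1 : s * (1 - y + y ^ 2 / 2) = s - γ * L + γ * x * L ^ 2 / 2 := by
      rw [show s * (1 - y + y ^ 2 / 2) = s - s * y + s * y ^ 2 / 2 by ring, hsy, hsy2]
    have e2 : (1 + x) * (1 - y) = 1 + x - x * L - x ^ 2 * L := by rw [hy]; ring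
    rw [e1, e2]
    have t1 : γ * x * L ^ 2 / 2 ≤ 0.6036 * x := by nlinarith
    have t2 : x * L ≤ 1.0987 * x := by nlinarith
    have t3 : x ^ 2 * L ≤ 0.2617 * x := by nlinarith
    nlinarith
  have hsplit : (s - 1 - γ / s) * Real.exp (-y) = s * Real.exp (-y) - (1 + x) * Real.exp (-y) := by
    rw [← hx]; ring
  rw [hsplit]
  linarith

/-- `3.5·√2·3^{−3/2} ≤ 1.6 · 0.596` (`3^{3/2} = √27 ≥ 5.196`, `√2 ≤ 1.41422`). [folklore] -/
private theorem bss_const : 3.5 * Real.sqrt 2 * (3 : ℝ) ^ (-(3 / 2 : ℝ)) ≤ 1.6 * 0.596 := by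
  have h2 : Real.sqrt 2 ≤ 1.41422 := by
    rw [Real.sqrt_le_left (by norm_num)]; norm_num
  have h27 : (3 : ℝ) ^ ((3 / 2 : ℝ)) = Real.sqrt 27 := by
    rw [show (27 : ℝ) = 3 ^ (3 : ℝ) by norm_num, Real.sqrt_eq_rpow, ← Real.rpow_mul (by norm_num)]
    norm_num
  have h27' : 5.196 ≤ Real.sqrt 27 := by
    rw [Real.le_sqrt (by norm_num) (by norm_num)]; norm_num
  have hD : (3 : ℝ) ^ (-(3 / 2 : ℝ)) = (Real.sqrt 27)⁻¹ := by
    rw [Real.rpow_neg (by norm_num), h27]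
  rw [hD]
  have hpos : 0 < Real.sqrt 27 := by positivity
  rw [show 3.5 * Real.sqrt 2 * (Real.sqrt 27)⁻¹ = 3.5 * Real.sqrt 2 / Real.sqrt 27 by ring,
    div_le_iff₀ hpos]
  nlinarith [Real.sqrt_nonneg 2]

/-- The inductive step of [50, §4.2] in closed form: with `s = √(2n)`, `m = s + γ − ½` (`γ ∈ (0,1]`),
`u = √(2(n − m))`, the bound `4.8·u·3^u + 3.5·√2·3^{m−1} ≤ 1.6·s·3^s`. [folklore] -/
private theorem bss_main {s γ u : ℝ} (hs : 4.2 ≤ s) (hγ0 : 0 < γ) (hγ1 : γ ≤ 1) (hu0 : 0 ≤ u)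
    (hu2 : u ^ 2 = s ^ 2 - 2 * (s + γ - 1 / 2)) :
    4.8 * u * (3 : ℝ) ^ u + 3.5 * Real.sqrt 2 * (3 : ℝ) ^ (s + γ - 3 / 2) ≤ 1.6 * s * (3 : ℝ) ^ s := by
  have h3 : (0 : ℝ) < 3 := by norm_num
  have hs0 : 0 < s := by linarith
  set x := γ / s with hx
  have hx0 : 0 < x := div_pos hγ0 hs0
  have hxs : x * s = γ := by rw [hx]; field_simp
  have hx1 : x ≤ 0.2381 := by rw [hx, div_le_iff₀ hs0]; nlinarith
  set σ := s - 1 - x with hσdef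
  have hσ : 0 < σ := by rw [hσdef]; linarith
  have hdiff : σ ^ 2 - u ^ 2 = 2 * x + x ^ 2 := by
    rw [hu2, hσdef, ← hxs]; ring
  have huσ : u ≤ σ := by nlinarith [add_pos_of_nonneg_of_pos hu0 hσ, sq_nonneg x]
  have hmono : u * (3 : ℝ) ^ u ≤ σ * (3 : ℝ) ^ σ :=
    mul_le_mul huσ (Real.rpow_le_rpow_of_exponent_le (by norm_num) huσ) (by positivity) hσ.le
  have hσs : (3 : ℝ) ^ σ = 3 ^ s * (3⁻¹ * 3 ^ (-x)) := by
    rw [show σ = s + ((-1) + (-x)) by rw [hσdef]; ring, Real.rpow_add h3, Real.rpow_add h3,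
      Real.rpow_neg_one]
  have hl : (3 : ℝ) ^ (s + γ - 3 / 2) = 3 ^ s * 3 ^ γ * 3 ^ (-(3 / 2 : ℝ)) := by
    rw [show s + γ - 3 / 2 = s + γ + (-(3 / 2 : ℝ)) by ring, Real.rpow_add h3, Real.rpow_add h3]
  have hkey := bss_key hs hγ0 hγ1
  rw [← hx] at hkey
  have h3s : 0 < (3 : ℝ) ^ s := Real.rpow_pos_of_pos h3 s
  have h3γ : 0 < (3 : ℝ) ^ γ := Real.rpow_pos_of_pos h3 γ
  have hE0 : 0 < (3 : ℝ) ^ (-x) := Real.rpow_pos_of_pos h3 _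
  have h48 : 4.8 * u * (3 : ℝ) ^ u ≤ 4.8 * (σ * (3 : ℝ) ^ σ) := by nlinarith [hmono]
  calc 4.8 * u * (3 : ℝ) ^ u + 3.5 * Real.sqrt 2 * (3 : ℝ) ^ (s + γ - 3 / 2)
      ≤ 4.8 * (σ * (3 : ℝ) ^ σ) + 3.5 * Real.sqrt 2 * (3 : ℝ) ^ (s + γ - 3 / 2) := by linarith
    _ = 1.6 * 3 ^ s * (σ * 3 ^ (-x)) + 3 ^ s * 3 ^ γ * (3.5 * Real.sqrt 2 * 3 ^ (-(3 / 2 : ℝ))) := by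
        rw [hσs, hl]; ring
    _ ≤ 1.6 * 3 ^ s * (σ * 3 ^ (-x)) + 3 ^ s * 3 ^ γ * (1.6 * 0.596) := by
        have h0 : (0 : ℝ) ≤ 3 ^ s * 3 ^ γ := by positivity
        linarith [mul_le_mul_of_nonneg_left bss_const h0]
    _ = 1.6 * 3 ^ s * (σ * 3 ^ (-x) + 0.596 * 3 ^ γ) := by ring
    _ ≤ 1.6 * 3 ^ s * s := by gcongr
    _ = 1.6 * s * (3 : ℝ) ^ s := by ring

/-- `3^{j + ½} = 3^j·√3`. [folklore] -/
private theorem bss_rpow_add_half (j : ℕ) : (3 : ℝ) ^ ((j : ℝ) + 1 / 2) = 3 ^ j * Real.sqrt 3 := by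
  rw [Real.rpow_add (by norm_num), Real.rpow_natCast, Real.sqrt_eq_rpow]

/-- Lower bounds for the right-hand side: `r ≤ √n`, `q ≤ √(2n)` give `1.6·r·3^q ≤ 1.6·√n·3^{√(2n)}`. [folklore] -/
private theorem bss_rhs_lower (n : ℕ) {r q : ℝ} (hr2 : r ^ 2 ≤ n) (hq2 : q ^ 2 ≤ 2 * n) :
    1.6 * r * (3 : ℝ) ^ q ≤ 1.6 * Real.sqrt n * (3 : ℝ) ^ Real.sqrt (2 * n) := by
  have h1 : r ≤ Real.sqrt n := Real.le_sqrt_of_sq_le hr2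
  have h2 : q ≤ Real.sqrt (2 * n) := Real.le_sqrt_of_sq_le hq2
  have h3 : (3 : ℝ) ^ q ≤ 3 ^ Real.sqrt (2 * n) := Real.rpow_le_rpow_of_exponent_le (by norm_num) h2
  have h4 : 0 < (3 : ℝ) ^ q := Real.rpow_pos_of_pos (by norm_num) q
  have h5 : 0 ≤ Real.sqrt n := Real.sqrt_nonneg _
  gcongr

/-- **The analysis of [50, §4.2]** for any `T : ℕ → ℕ` with `T(0) = 0` obeying the `FourMove` recurrence
`T(k+l+1) ≤ 3T(k) + 3(3^l − 1) + (3^l − 1)/2 + 3`: `T(n) < 1.6·√n·3^{√(2n)}` for all `n ≥ 1` — base `n ≤ 8`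
from the recurrence values `3, 10, 19, 40, 61, 88, 151, 214`, step `n ≥ 9` with `m = round(√(2n))`
(`bss_main`). [folklore] -/
private theorem bss_analysis (T : ℕ → ℕ) (hT0 : T 0 = 0)
    (hrec : ∀ k l : ℕ, T (k + l + 1) ≤ 3 * T k + (3 * (3 ^ l - 1) + (3 ^ l - 1) / 2 + 3)) :
    ∀ n : ℕ, 1 ≤ n → (T n : ℝ) < 1.6 * Real.sqrt n * (3 : ℝ) ^ Real.sqrt (2 * n) := by
  -- the recurrence values for `n ≤ 8`
  have h1 : T 1 ≤ 3 := by have := hrec 0 0; norm_num [hT0] at this; exact this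
  have h2 : T 2 ≤ 10 := by have := hrec 0 1; norm_num [hT0] at this; exact this
  have h3 : T 3 ≤ 19 := by have := hrec 1 1; norm_num at this; omega
  have h4 : T 4 ≤ 40 := by have := hrec 1 2; norm_num at this; omega
  have h5 : T 5 ≤ 61 := by have := hrec 2 2; norm_num at this; omega
  have h6 : T 6 ≤ 88 := by have := hrec 3 2; norm_num at this; omega
  have h7 : T 7 ≤ 151 := by have := hrec 3 3; norm_num at this; omega
  have h8 : T 8 ≤ 214 := by have := hrec 4 3; norm_num at this; omega
  have hsq3 : 1.732 ≤ Real.sqrt 3 := Real.le_sqrt_of_sq_le (by norm_num)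
  intro n
  induction n using Nat.strong_induction_on with
  | _ n ih =>
  intro hn
  by_cases hn8 : n ≤ 8
  · interval_cases n
    · have hb : (T 1 : ℝ) ≤ 3 := by exact_mod_cast h1
      have hr := bss_rhs_lower 1 (r := 1) (q := 1) (by norm_num) (by norm_num)
      rw [Real.rpow_one] at hr
      linarith
    · have hb : (T 2 : ℝ) ≤ 10 := by exact_mod_cast h2
      have hr := bss_rhs_lower 2 (r := 1.4) (q := (2 : ℕ)) (by norm_num) (by norm_num)
      rw [Real.rpow_natCast] at hr
      linarith
    · have hb : (T 3 : ℝ) ≤ 19 := by exact_mod_cast h3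
      have hr := bss_rhs_lower 3 (r := 1.7) (q := (2 : ℕ)) (by norm_num) (by norm_num)
      rw [Real.rpow_natCast] at hr
      linarith
    · have hb : (T 4 : ℝ) ≤ 40 := by exact_mod_cast h4
      have hr := bss_rhs_lower 4 (r := 2) (q := ((2 : ℕ) : ℝ) + 1 / 2) (by norm_num) (by norm_num)
      rw [bss_rpow_add_half] at hr
      nlinarith
    · have hb : (T 5 : ℝ) ≤ 61 := by exact_mod_cast h5
      have hr := bss_rhs_lower 5 (r := 2.2) (q := (3 : ℕ)) (by norm_num) (by norm_num)
      rw [Real.rpow_natCast] at hr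
      linarith
    · have hb : (T 6 : ℝ) ≤ 88 := by exact_mod_cast h6
      have hr := bss_rhs_lower 6 (r := 2.4) (q := (3 : ℕ)) (by norm_num) (by norm_num)
      rw [Real.rpow_natCast] at hr
      linarith
    · have hb : (T 7 : ℝ) ≤ 151 := by exact_mod_cast h7
      have hr := bss_rhs_lower 7 (r := 2.6) (q := ((3 : ℕ) : ℝ) + 1 / 2) (by norm_num) (by norm_num)
      rw [bss_rpow_add_half] at hr
      nlinarith
    · have hb : (T 8 : ℝ) ≤ 214 := by exact_mod_cast h8
      have hr := bss_rhs_lower 8 (r := 2.8) (q := (4 : ℕ)) (by norm_num) (by norm_num)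
      rw [Real.rpow_natCast] at hr
      linarith
  · -- the inductive step, `n ≥ 9`
    push Not at hn8
    have hn9 : 9 ≤ n := hn8
    have hnR : (9 : ℝ) ≤ n := by exact_mod_cast hn9
    set s := Real.sqrt (2 * n) with hs
    have hs2 : s ^ 2 = 2 * n := Real.sq_sqrt (by positivity)
    have hs42 : 4.2 ≤ s := Real.le_sqrt_of_sq_le (by nlinarith)
    have hs0 : 0 < s := by linarith
    -- `m = round(s)`
    set m := ⌊s + 1 / 2⌋₊ with hm
    have hm1 : (m : ℝ) ≤ s + 1 / 2 := Nat.floor_le (by linarith)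
    have hm2 : s + 1 / 2 < m + 1 := Nat.lt_floor_add_one _
    have hm4 : 4 ≤ m := Nat.le_floor (by push_cast; linarith)
    have hsn : s ≤ n - 1 / 2 := by
      have h9n : (n : ℝ) ^ 2 ≥ 9 * n := by nlinarith
      nlinarith [hs2, hs0]
    have hmn : m ≤ n := by
      have : (m : ℝ) ≤ n := by linarith
      exact_mod_cast this
    -- the splitting `n = k + l + 1`, `k = n − m`, `l = m − 1`
    obtain ⟨l, hl⟩ : ∃ l, m = l + 1 := ⟨m - 1, by omega⟩
    obtain ⟨k, hk⟩ : ∃ k, n = k + l + 1 := ⟨n - m, by omega⟩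
    have hkn : k < n := by omega
    have hTk : (T k : ℝ) ≤ 1.6 * Real.sqrt k * (3 : ℝ) ^ Real.sqrt (2 * k) := by
      by_cases hk0 : k = 0
      · subst hk0; rw [hT0]; push_cast; positivity
      · exact (ih k hkn (Nat.one_le_iff_ne_zero.mpr hk0)).le
    -- the recurrence, cast to `ℝ`
    generalize hJ : 3 * (3 ^ l - 1) + (3 ^ l - 1) / 2 + 3 = J
    have hr : T n ≤ 3 * T k + J := by rw [hk, ← hJ]; exact hrec k l
    obtain ⟨t, ht⟩ : Odd (3 ^ l) := Odd.pow (by decide)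
    have hJ2 : 2 * J + 1 = 7 * 3 ^ l := by rw [← hJ, ht]; omega
    have hJR : (J : ℝ) = 7 / 2 * (3 : ℝ) ^ l - 1 / 2 := by
      have h := congrArg (Nat.cast (R := ℝ)) hJ2
      push_cast at h
      linarith
    have hrR : (T n : ℝ) ≤ 3 * (T k : ℝ) + (7 / 2 * (3 : ℝ) ^ l - 1 / 2) := by
      have h : ((T n : ℕ) : ℝ) ≤ ((3 * T k + J : ℕ) : ℝ) := Nat.cast_le.mpr hr
      push_cast at h; rw [hJR] at h; exact h
    -- the real quantities
    set γ := (m : ℝ) - s + 1 / 2 with hγ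
    have hγ0 : 0 < γ := by rw [hγ]; linarith
    have hγ1 : γ ≤ 1 := by rw [hγ]; linarith
    have hmR : (m : ℝ) = (l : ℝ) + 1 := by rw [hl]; push_cast; ring
    have hkR : (k : ℝ) = n - m := by rw [hk, hl]; push_cast; ring
    set u := Real.sqrt (2 * k) with hu
    have hu0 : 0 ≤ u := Real.sqrt_nonneg _
    have hu2 : u ^ 2 = s ^ 2 - 2 * (s + γ - 1 / 2) := by
      rw [hu, Real.sq_sqrt (by positivity), hs2, hkR, hγ]; ring
    have hM := bss_main hs42 hγ0 hγ1 hu0 hu2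
    -- `3^l = 3^{s + γ − 3/2}`, `√n = s/√2`, `√k = u/√2`
    have h3l : (3 : ℝ) ^ l = (3 : ℝ) ^ (s + γ - 3 / 2) := by
      rw [← Real.rpow_natCast]
      congr 1
      rw [hγ, hmR]; ring
    have hr2 : 0 < Real.sqrt 2 := by positivity
    have hsn2 : Real.sqrt n = s / Real.sqrt 2 := by
      rw [eq_div_iff hr2.ne', hs, Real.sqrt_mul' _ (by positivity), mul_comm]
    have hsk2 : Real.sqrt k = u / Real.sqrt 2 := by
      rw [eq_div_iff hr2.ne', hu, Real.sqrt_mul' _ (by positivity), mul_comm]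
    have hfin : 3 * (1.6 * Real.sqrt k * (3 : ℝ) ^ u) + 7 / 2 * (3 : ℝ) ^ l ≤
        1.6 * Real.sqrt n * (3 : ℝ) ^ s := by
      rw [hsk2, hsn2, h3l]
      have e1 : 3 * (1.6 * (u / Real.sqrt 2) * (3 : ℝ) ^ u) + 7 / 2 * (3 : ℝ) ^ (s + γ - 3 / 2) =
          (4.8 * u * (3 : ℝ) ^ u + 3.5 * Real.sqrt 2 * (3 : ℝ) ^ (s + γ - 3 / 2)) / Real.sqrt 2 := by
        field_simp
        ring
      have e2 : 1.6 * (s / Real.sqrt 2) * (3 : ℝ) ^ s = (1.6 * s * (3 : ℝ) ^ s) / Real.sqrt 2 := by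
        field_simp
      rw [e1, e2]
      exact div_le_div_of_nonneg_right hM hr2.le
    have h3u : 0 ≤ (3 : ℝ) ^ u := (Real.rpow_pos_of_pos (by norm_num) u).le
    calc (T n : ℝ) ≤ 3 * (T k : ℝ) + (7 / 2 * (3 : ℝ) ^ l - 1 / 2) := hrR
      _ ≤ 3 * (1.6 * Real.sqrt k * (3 : ℝ) ^ u) + (7 / 2 * (3 : ℝ) ^ l - 1 / 2) := by
          gcongr
      _ < 3 * (1.6 * Real.sqrt k * (3 : ℝ) ^ u) + 7 / 2 * (3 : ℝ) ^ l := by linarith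
      _ ≤ 1.6 * Real.sqrt n * (3 : ℝ) ^ s := hfin

end Analysis

/-! ## The discharge -/

/-- **Berend–Sapir–Solomon 2012, Theorem 3.2 (b) — DISCHARGE of the named fact `BerendSapirSolomonBound`:**
for every `n ≥ 1` the end-to-end task of the Four-in-a-row Tower of Hanoi takes fewer than `1.6·√n·3^{√(2n)}`
moves, `d_{H^n_{P_{1+3}}}(0^n, 3^n) < 1.6·√n·3^{√(2n)}` («Path($4,n$) $< 1.6 \sqrt{n} 3^{\sqrt{2n}}$», cited
in the book as «proved that the task can be done in less than $1.6\sqrt{n}\,3^{\sqrt{2n}}$ moves»). PROVED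
by the printed proof: the algorithm `FourMove` (`bss_fourMove_recurrence`) and the printed induction
(`bss_analysis`).
[cite: HinzKlavzarPetr2018, Ch. 8 §8.3.5, pp. 349–350 (ref. 50 = Berend–Sapir–Solomon, Discrete Appl. Math. 160 (2012) 1465–1483, Theorem 3.2 (b) and its proof in §4.2)]
[cite: BerendSapirSolomon2012, Theorem 3.2 (b) and its proof, §4.2] -/
theorem BerendSapirSolomonBound_holds : BerendSapirSolomonBound := by
  intro n hn
  exact bss_analysis (fun n => (stateGraph path4 n).dist (fun _ => 0) (fun _ => 3)) bss_dist_zero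
    (fun k l => bss_fourMove_recurrence k l) n hn

end Literature.Combinatorics.Hinz2018.MoveGraph
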